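import Literature.AnabelianGeometry.EtaleTheta.SettingModel2Theta
import HarnessLib

/-!
# A FINER model of the [EtTh] §1 root, part B2: the coverings `Δ^tp_{Y_N}`, `Δ^tp_{Z_N}` of `Γ = F̂₂ ×_Ẑ ℤ`

Mochizuki, *The étale theta function …*, Publ. RIMS **45** (2009) [EtTh], §1, PRIMS PDF pp. 13–14 and 18
[cite: MochizukiEtTh2009, §1 p.13]. Layer L2 of the abc-iut cell, seat abc-iut-L2-t1 (root owner); third file of
the finer model (after `SettingModel2Curve`, `SettingModel2Theta`). From the profinite level maps
`ĥ_N : F̂₂ →ₜ* Heis(ℤ/N)` we define the level homomorphisms `Γ → Heis(ℤ/N)` and the open normal subgroups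
`Δ^tp_{Y_N} := Ker pr₂ ∩ ĥ_N⁻¹{x = y = 0}`, `Δ^tp_{Z_N} := Ker pr₂ ∩ Ker ĥ_N` of `Γ`, prove `Y₁ = Z₁ = Ker pr₂`,
antitonicity in `N`, and the indices `[Ker pr₂ : Δ^tp_{Y_N}] = [Δ^tp_{Y_N} : Δ^tp_{Z_N}] = N` (the `y`- and
`z`-coordinates are onto `ℤ/N`, witnessed by the graph elements of `b` and `⁅a,b⁆`). Model plumbing only;
nothing of [EtTh] asserted; no side taken on [IUTchIII] Cor. 3.12.
-/

noncomputable section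

namespace Literature.AnabelianGeometry.EtaleTheta.SettingModel

open Literature.AnabelianGeometry.SemiGraphs
open CategoryTheory Function
open scoped commutatorElement

/-! ### The level subgroups `Δ^tp_{Y_N} ⊇ Δ^tp_{Z_N}` of the fibre product -/

/-- `Γ → Heis (ℤ/N)`: the level map on the fibre product. [cite: MochizukiEtTh2009, §1 p.13] -/
def levelHom (N : ℕ+) : Gfp →* Heis (ZMod N) := (hHat N).toMonoidHom.comp gfpFst.toMonoidHom

/-- [cite: MochizukiEtTh2009, §1 p.13] -/
theorem levelHom_continuous (N : ℕ+) : Continuous (levelHom N) := (hHat N).continuous.comp gfpFst.continuous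

/-- On `Ker pr₂` the `x`-coordinate of the level map vanishes. [cite: MochizukiEtTh2009, §1 p.13] -/
theorem levelHom_x_eq_zero {N : ℕ+} {γ : Gfp} (hγ : γ ∈ gfpSnd.ker) : (levelHom N γ).x = 0 := by
  have h1 : eHat (γ : F₂hatT × Multiplicative ℤ).1 = 1 := by
    rw [(mem_Gfp _).mp γ.2, show (γ : F₂hatT × Multiplicative ℤ).2 = 1 from hγ, map_one]
  exact hHat_x_eq_zero_of_eHat_eq_one N h1

/-- The `z`-axis `{x = 0, y = 0}` is normal (central). [folklore] -/
private theorem zAxis_normal (R : Type*) [CommRing R] : (Heis.zAxis : Subgroup (Heis R)).Normal :=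
  ⟨fun a ha g => by
    rw [show g * a * g⁻¹ = a from by
      rw [(Subgroup.mem_center_iff.mp (Heis.zAxis_le_center ha) g), mul_inv_cancel_right]]
    exact ha⟩

/-- `Δ^tp_{Y_N} := Ker pr₂ ∩ ĥ_N⁻¹{x = y = 0}`. [cite: MochizukiEtTh2009, §1 p.13] -/
def dY (N : ℕ+) : Subgroup Gfp := gfpSnd.ker ⊓ (Heis.zAxis : Subgroup (Heis (ZMod N))).comap (levelHom N)

/-- `Δ^tp_{Z_N} := Ker pr₂ ∩ Ker ĥ_N`. [cite: MochizukiEtTh2009, §1 p.14] -/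
def dZ (N : ℕ+) : Subgroup Gfp := gfpSnd.ker ⊓ (levelHom N).ker

/-- [cite: MochizukiEtTh2009, §1 p.13] -/
theorem dY_normal (N : ℕ+) : (dY N).Normal := by
  haveI := zAxis_normal (ZMod N)
  haveI : ((Heis.zAxis : Subgroup (Heis (ZMod N))).comap (levelHom N)).Normal :=
    Subgroup.Normal.comap inferInstance _
  exact Subgroup.normal_inf_normal _ _

/-- [cite: MochizukiEtTh2009, §1 p.14] -/
theorem dZ_normal (N : ℕ+) : (dZ N).Normal := Subgroup.normal_inf_normal _ _

/-- [cite: MochizukiEtTh2009, §1 p.13] -/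
theorem isOpen_dY (N : ℕ+) : IsOpen (dY N : Set Gfp) := by
  rw [dY, Subgroup.coe_inf, Subgroup.coe_comap]
  exact isOpen_ker_gfpSnd.inter ((isOpen_discrete _).preimage (levelHom_continuous N))

/-- [cite: MochizukiEtTh2009, §1 p.14] -/
theorem isOpen_dZ (N : ℕ+) : IsOpen (dZ N : Set Gfp) := by
  rw [dZ, Subgroup.coe_inf]
  refine isOpen_ker_gfpSnd.inter ?_
  have : ((levelHom N).ker : Set Gfp) = levelHom N ⁻¹' {1} := by ext; simp [MonoidHom.mem_ker]
  rw [this]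
  exact (isOpen_discrete _).preimage (levelHom_continuous N)

/-- [cite: MochizukiEtTh2009, §1 p.14] -/
theorem dZ_le_dY (N : ℕ+) : dZ N ≤ dY N := fun γ hγ => by
  obtain ⟨h1, h2⟩ := Subgroup.mem_inf.mp hγ
  rw [MonoidHom.mem_ker] at h2
  refine Subgroup.mem_inf.mpr ⟨h1, Subgroup.mem_comap.mpr ?_⟩
  rw [h2]
  exact ⟨rfl, rfl⟩

/-- [cite: MochizukiEtTh2009, §1 p.13] -/
theorem dY_le (N : ℕ+) : dY N ≤ gfpSnd.ker := fun _ h => (Subgroup.mem_inf.mp h).1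

/-- [folklore] -/
private theorem subsingleton_zmod_one : Subsingleton (ZMod ((1 : ℕ+) : ℕ)) := by
  rw [PNat.one_coe]; infer_instance

/-- [folklore] -/
private theorem levelHom_one_eq (γ : Gfp) : levelHom 1 γ = 1 := by
  haveI := subsingleton_zmod_one
  ext <;> exact Subsingleton.elim _ _

/-- `Δ^tp_{Y_1} = Ker pr₂`. [cite: MochizukiEtTh2009, §1 p.14] -/
theorem dY_one : dY 1 = gfpSnd.ker :=
  le_antisymm (dY_le 1) fun γ hγ =>
    Subgroup.mem_inf.mpr ⟨hγ, Subgroup.mem_comap.mpr (by rw [levelHom_one_eq γ]; exact ⟨rfl, rfl⟩)⟩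

/-- `Δ^tp_{Z_1} = Δ^tp_{Y_1}`. [cite: MochizukiEtTh2009, §1 p.14] -/
theorem dZ_one : dZ 1 = dY 1 :=
  le_antisymm (dZ_le_dY 1) fun γ hγ =>
    Subgroup.mem_inf.mpr ⟨(Subgroup.mem_inf.mp hγ).1, by
      rw [MonoidHom.mem_ker]; exact levelHom_one_eq γ⟩

/-- [cite: MochizukiEtTh2009, §1 p.18] -/
theorem dY_anti {M N : ℕ+} (h : (M : ℕ) ∣ N) : dY N ≤ dY M := by
  intro γ hγ
  obtain ⟨h1, h2⟩ := Subgroup.mem_inf.mp hγ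
  obtain ⟨hx, hy⟩ := Subgroup.mem_comap.mp h2
  have e := map_hHat_of_dvd h (γ : F₂hatT × Multiplicative ℤ).1
  change Heis.map _ (levelHom N γ) = levelHom M γ at e
  refine Subgroup.mem_inf.mpr ⟨h1, Subgroup.mem_comap.mpr ⟨?_, ?_⟩⟩
  · show (levelHom M γ).x = 0
    rw [← e, Heis.map_apply]; simp [hx]
  · show (levelHom M γ).y = 0
    rw [← e, Heis.map_apply]; simp [hy]

/-- [cite: MochizukiEtTh2009, §1 p.18] -/
theorem dZ_anti {M N : ℕ+} (h : (M : ℕ) ∣ N) : dZ N ≤ dZ M := by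
  intro γ hγ
  obtain ⟨h1, h2⟩ := Subgroup.mem_inf.mp hγ
  rw [MonoidHom.mem_ker] at h2
  have e := map_hHat_of_dvd h (γ : F₂hatT × Multiplicative ℤ).1
  change Heis.map _ (levelHom N γ) = levelHom M γ at e
  refine Subgroup.mem_inf.mpr ⟨h1, ?_⟩
  rw [MonoidHom.mem_ker, ← e, h2, map_one]

/-- The graph element `(η g, expA g)` of `Γ`. [cite: MochizukiEtTh2009, §1 p.12] -/
def gfpOf (g : F₂) : Gfp := ⟨(eta g, expA g), eta_mk_mem_Gfp g⟩

/-- [cite: MochizukiEtTh2009, §1 p.12] -/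
theorem levelHom_gfpOf (N : ℕ+) (g : F₂) :
    levelHom N (gfpOf g) = Heis.map (Int.castRingHom (ZMod N)) (heisHom g) := hHat_eta N g

/-- **`[Δ^tp_Y : Δ^tp_{Y_N}] = N`** in the finer model (`y`-coordinate of the level map on `Ker pr₂` is onto
`ℤ/N`: the loop `b`). [cite: MochizukiEtTh2009, §1 p.16] -/
theorem relIndex_dY (N : ℕ+) : (dY N).relIndex gfpSnd.ker = N := by
  let f : gfpSnd.ker →* Multiplicative (ZMod N) := (Heis.yHom).comp ((levelHom N).comp gfpSnd.ker.subtype)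
  have hker : (dY N).subgroupOf gfpSnd.ker = f.ker := by
    ext γ
    rw [Subgroup.mem_subgroupOf, MonoidHom.mem_ker]
    constructor
    · intro h
      have hy : (levelHom N γ.1).y = 0 := (Subgroup.mem_comap.mp (Subgroup.mem_inf.mp h).2).2
      show Heis.yHom (levelHom N γ.1) = 1
      rw [Heis.yHom_apply, hy]; rfl
    · intro h
      have hy : (levelHom N γ.1).y = 0 := by
        have h' : Heis.yHom (levelHom N γ.1) = 1 := h
        rw [Heis.yHom_apply] at h'
        exact ofAdd_eq_one.mp h'
      exact Subgroup.mem_inf.mpr ⟨γ.2, Subgroup.mem_comap.mpr ⟨levelHom_x_eq_zero γ.2, hy⟩⟩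
  have hb : gfpOf (FreeGroup.of 1) ∈ gfpSnd.ker := by
    show expA (FreeGroup.of 1) = 1
    rw [expA_apply, heisHom_of_one]; rfl
  have hsurj : Surjective f := by
    have h1 : f ⟨_, hb⟩ = Multiplicative.ofAdd 1 := by
      simp [f, levelHom_gfpOf, heisHom_of_one]
    intro t
    obtain ⟨k, hk⟩ := ZMod.intCast_surjective (Multiplicative.toAdd t)
    refine ⟨⟨_, hb⟩ ^ k, ?_⟩
    rw [map_zpow, h1, ← ofAdd_zsmul, zsmul_one, hk, ofAdd_toAdd]
  rw [Subgroup.relIndex, hker, Subgroup.index_ker, MonoidHom.range_eq_top.mpr hsurj, Subgroup.card_top]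
  exact Nat.card_zmod N

/-- **`[Δ^tp_{Y_N} : Δ^tp_{Z_N}] = N`** in the finer model (`z`-coordinate on `Δ^tp_{Y_N}`, where it is additive,
is onto `ℤ/N`: the commutator `⁅a,b⁆`). [cite: MochizukiEtTh2009, §1 p.14] -/
theorem relIndex_dZ (N : ℕ+) : (dZ N).relIndex (dY N) = N := by
  let f : dY N →* Multiplicative (ZMod N) :=
    { toFun := fun γ => Multiplicative.ofAdd (levelHom N γ.1).z
      map_one' := by simp
      map_mul' := fun γ δ => by
        have hx : (levelHom N γ.1).x = 0 := levelHom_x_eq_zero (Subgroup.mem_inf.mp γ.2).1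
        rw [← ofAdd_add, Subgroup.coe_mul, map_mul, Heis.mul_z, hx, zero_mul, add_zero] }
  have hker : (dZ N).subgroupOf (dY N) = f.ker := by
    ext γ
    rw [Subgroup.mem_subgroupOf, MonoidHom.mem_ker]
    constructor
    · intro h
      have h2 : levelHom N γ.1 = 1 := (Subgroup.mem_inf.mp h).2
      show Multiplicative.ofAdd (levelHom N γ.1).z = 1
      rw [h2]; rfl
    · intro h
      have hz : (levelHom N γ.1).z = 0 := ofAdd_eq_one.mp h
      have hx : (levelHom N γ.1).x = 0 := levelHom_x_eq_zero (Subgroup.mem_inf.mp γ.2).1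
      have hy : (levelHom N γ.1).y = 0 := (Subgroup.mem_comap.mp (Subgroup.mem_inf.mp γ.2).2).2
      refine Subgroup.mem_inf.mpr ⟨(Subgroup.mem_inf.mp γ.2).1, ?_⟩
      rw [MonoidHom.mem_ker]
      ext <;> simp [hx, hy, hz]
  have hc : gfpOf ⁅FreeGroup.of (0 : Fin 2), FreeGroup.of 1⁆ ∈ dY N := by
    refine Subgroup.mem_inf.mpr ⟨?_, Subgroup.mem_comap.mpr ?_⟩
    · show expA ⁅FreeGroup.of (0 : Fin 2), FreeGroup.of 1⁆ = 1
      rw [expA_apply, heisHom_commutator]; rfl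
    · rw [levelHom_gfpOf, heisHom_commutator]
      exact ⟨by simp, by simp⟩
  have hsurj : Surjective f := by
    have h1 : f ⟨_, hc⟩ = Multiplicative.ofAdd 1 := by
      show Multiplicative.ofAdd (levelHom N (gfpOf ⁅FreeGroup.of (0 : Fin 2), FreeGroup.of 1⁆)).z = _
      rw [levelHom_gfpOf, heisHom_commutator, Heis.map_apply]
      simp
    intro t
    obtain ⟨k, hk⟩ := ZMod.intCast_surjective (Multiplicative.toAdd t)
    refine ⟨⟨_, hc⟩ ^ k, ?_⟩
    rw [map_zpow, h1, ← ofAdd_zsmul, zsmul_one, hk, ofAdd_toAdd]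
  rw [Subgroup.relIndex, hker, Subgroup.index_ker, MonoidHom.range_eq_top.mpr hsurj, Subgroup.card_top]
  exact Nat.card_zmod N

end Literature.AnabelianGeometry.EtaleTheta.SettingModel

end
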